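import Mathlib
import HarnessLib
import Summits.HubbardSuperconductivity.HubbardSuperconductivity.Theorems.KLProgrammeH10TwoPointLimitSectorMultiplierOverlap
import Summits.HubbardSuperconductivity.HubbardSuperconductivity.Theorems.KLProgrammeKLRegimeSplitThermalLayerExt
import Summits.HubbardSuperconductivity.HubbardSuperconductivity.Theorems.KLProgrammeKLRegimeEngineSymbolThresholds
import Summits.HubbardSuperconductivity.HubbardSuperconductivity.Theorems.KLProgrammeKLRegimeEngineThresholdBridges

/-!
# Route `KLProgramme` — engine support, route (L2): `hrow′/hcol′` of the single-scale step IN THE KL REGIME, keyed by `FrameOK` —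
# ONE absolute constant `C_B` for every admissible frame, every package `R`, every `β`, `L`, `M` and every scale `1 ≤ n ≤ n_β + 1`

Cell `gate-hubbard-kl`, seat p4 (C5a lead), g7.  The frame-keyed `overlap_sums_klAniso_bgmFat_le` (`…SectorMultiplierOverlap`) at the
engine's data: `e₀ = klE0`, zone margin `z = 1/10`, window band bounds `bandBounds (-6/5) (-1/10)` (which contains `klWindowC` with the margins
`A + e₀`), frame size `A := κ₀/4` with `κ₀ = min (min (Dt_min/4) (ρ_min/4)) (1/40)`, the cutoff constants `d`, `B_a` of
`exists_abs_derivs_bgmCutoffSq_le` / `exists_norm_iteratedDeriv_sectorWeightCirc_polarAngle_line_le 2`.  In the regime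
`klBetaMin ≤ β ≤ e^{c/U²}` an admissible frame `FrameOK R U (nScales β) μ K` has `C²` size `≤ 2Gfr₀U + 2Gfr₁U² + Gfr₂c/log 4`
(`norm_iteratedFDeriv_frameShift_le_of_frameOK_regime`), which is `≤ κ₀/4` once `c ≤ κ₀/(12(Gfr₂+1))`, `U ≤ min 1 (κ₀/(24(Gfr₀+Gfr₁+1)))`;
and for `1 ≤ n ≤ n_β + 1`, `β² ≤ L`, `β ≤ M` all scale thresholds of the frame-keyed theorem hold (`π/(4β) ≤ Λ_n`,
`klth_pi_div_le_klScale_nScales` + `klte_klScale_nScales_le_four_mul`; `4ⁿ ≤ β/(8π)`).  Result: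

* **`overlap_sums_klAniso_bgmFat_of_frameOK`** — `∃ κ₀ > 0, ∃ C_B > 0, ∀ R (Gfr ≥ 0), ∀ 0 < c ≤ κ₀/(12(Gfr₂+1)), ∀ 0 < U ≤ min 1 (κ₀/(24(Gfr₀+Gfr₁+1))),
  ∀ β ∈ [klBetaMin, e^{c/U²}], ∀ μ ∈ klWindowC, ∀ K, FrameOK R U (nScales β) μ K → ∀ L M, β² ≤ L → β ≤ M → ∀ n, 1 ≤ n ≤ nScales β + 1 →
  hrow′ ≤ C_B·M/β ∧ hcol′ ≤ 2C_B·M/β` for the pair `(klAnisoFamily … klE0 n, bgmFatMultiplier … klE0 … (n−1))`.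

With `ε_x = β/(2M)`: `ε_x·hrow′ ≤ C_B/2`, `ε_x·hcol′ ≤ C_B` — n-, β-, L-, M-, frame-UNIFORM, as BGM (2.77) requires.

* `overlap_sums_klAniso_bgmFat_of_thresholds (ha hab hb)` — the same with `κ₀ = min (min (Dt_min/4) (ρ_min/4)) (1/40)` of
  `bandBounds ha hab hb` EXPOSED (so that the engine's threshold bridges apply);
* **`overlap_sums_klAniso_bgmFat_klEng`** — `∃ C_B > 0`, the two bounds under EXACTLY the binders of `stub_engine_step_norms`
  (`P.WF`, `R.WF2`, `0 < c ≤ klEngC₃3 P R`, `0 < U ≤ klEngU₀3 P R c`, `klEngL₃ β U ≤ L`, `klEngM₃ β U L ≤ M`), via k3c2-p3's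
  `klEngC₃3_le_symbolC₃` / `klEngU₀3_le_symbolU₀` / `gfr_nonneg_of_wf2` and p3's `sq_le_of_klEngL₃_le` / `le_of_klEngM₃_le`.

Everything is proved; no definitions, no named facts. [cite: BenfattoGiulianiMastropietro2006, §2.7 (2.71a), §2.8 (2.77)]
-/

noncomputable section

namespace Summit.HubbardSuperconductivity.HubbardSuperconductivity.Theorems.TorusFourierL2

set_option linter.dupNamespace false -- summit = problem name (single-conjunct summit), D-0017

open Set Finset Literature.MathematicalPhysics.QuantumLattice Literature.MathematicalPhysics.QuantumLattice.BandSectorCounting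
open Literature.MathematicalPhysics.QuantumLattice.FermiRG Literature.Probability.LatticeModels Literature.Analysis.SpecialFunctions
open Summit.HubbardSuperconductivity.HubbardSuperconductivity.Theorems.DispersionFlow
open Summit.HubbardSuperconductivity.HubbardSuperconductivity.Theorems.KLRegimeSplit
open Summit.HubbardSuperconductivity.HubbardSuperconductivity.Theorems.KLProgrammeLegKernels
open Summit.HubbardSuperconductivity.HubbardSuperconductivity.Theorems.PerturbedFermiCurve
open scoped Real

/-- In the KL regime the scale thresholds of the frame-keyed theorem hold for `1 ≤ n ≤ n_β + 1`, `β² ≤ L`, `β ≤ M`: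
`Λ_nβ < π(2M − 3)`, `β e₀ ≤ M`, `2|2π/L|(2ⁿ + ½) ≤ 1/10`, `2π·16ⁿ ≤ L`, `π/(4β) ≤ Λ_n` (`e₀ = klE0`). [folklore] -/
theorem regime_scale_thresholds {β : ℝ} (hβmin : klBetaMin ≤ β) {L M : ℕ} (hL : β ^ 2 ≤ (L : ℝ)) (hM : β ≤ (M : ℝ)) {n : ℕ}
    (hn : n ≤ nScales β + 1) :
    klScale klE0 n * β < π * (2 * M - 3) ∧ β * klE0 ≤ M ∧ 2 * |2 * π / (L : ℝ)| * ((2 : ℝ) ^ n + 1 / 2) ≤ 1 / 10 ∧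
      2 * π * (16 : ℝ) ^ n ≤ L ∧ π / (4 * β) ≤ klScale klE0 n := by
  have hβ0 : 0 < β := pos_of_klBetaMin_le hβmin
  have hβ128 : 128 ≤ β := by simpa [klBetaMin] using hβmin
  have hπ := Real.pi_pos
  have hπ3 := Real.pi_gt_three
  have hL0 : (0 : ℝ) < L := lt_of_lt_of_le (by positivity) hL
  -- `π/(4β) ≤ Λ_n`
  have hΛβ : π / (4 * β) ≤ klScale klE0 n := by
    have h1 := klth_pi_div_le_klScale_nScales hβmin
    have h2 := klte_klScale_nScales_le_four_mul hn
    rw [div_le_iff₀ (by positivity)]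
    have e : π / β * β = π := by field_simp
    have h3 : π / β * β ≤ 4 * klScale klE0 n * β := mul_le_mul_of_nonneg_right (h1.trans h2) hβ0.le
    linarith
  -- `π·4ⁿ ≤ β/8`, hence `4ⁿ ≤ β`, `2ⁿ ≤ β`
  have hΛn : klScale klE0 n = (1 / 32) * ((4 : ℝ) ^ n)⁻¹ := by rw [klScale, klE0]
  have h4pos : (0 : ℝ) < (4 : ℝ) ^ n := by positivity
  have hπ4n : π * (4 : ℝ) ^ n ≤ β / 8 := by
    have h := hΛβ
    rw [hΛn, div_le_iff₀ (by positivity : (0 : ℝ) < 4 * β)] at h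
    have e : (1 / 32 : ℝ) * ((4 : ℝ) ^ n)⁻¹ * (4 * β) * (4 : ℝ) ^ n = β / 8 := by field_simp; ring
    rw [← e]; exact mul_le_mul_of_nonneg_right h h4pos.le
  have h4n : (4 : ℝ) ^ n ≤ β := by nlinarith
  have h2n : (2 : ℝ) ^ n ≤ β := (pow_le_pow_left₀ (by norm_num) (by norm_num : (2 : ℝ) ≤ 4) n).trans h4n
  refine ⟨?_, ?_, ?_, ?_, hΛβ⟩
  · have h1 : klScale klE0 n * β ≤ 1 / 32 * β :=
      calc klScale klE0 n * β ≤ klE0 * β := mul_le_mul_of_nonneg_right (klScale_le_e0 (by norm_num [klE0]) n) hβ0.le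
        _ = 1 / 32 * β := by rw [klE0]
    have h2 : 3 * (2 * (M : ℝ) - 3) ≤ π * (2 * M - 3) := mul_le_mul_of_nonneg_right hπ3.le (by linarith)
    linarith
  · rw [klE0]; linarith
  · rw [abs_of_pos (by positivity), show 2 * (2 * π / (L : ℝ)) * ((2 : ℝ) ^ n + 1 / 2) = 4 * π * ((2 : ℝ) ^ n + 1 / 2) / L by ring,
      div_le_iff₀ hL0]
    have hπ4 : π < 3.15 := Real.pi_lt_d2
    have hA' : 4 * π * ((2 : ℝ) ^ n + 1 / 2) ≤ 4 * 3.15 * (β + 1 / 2) := by gcongr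
    have hB' : 4 * 3.15 * (β + 1 / 2) ≤ 1 / 10 * (L : ℝ) := by
      nlinarith [hL, mul_nonneg (sub_nonneg.2 hβ128) (show (0 : ℝ) ≤ β + 2 by linarith)]
    linarith
  · have h16 : (16 : ℝ) ^ n = (4 : ℝ) ^ n * (4 : ℝ) ^ n := by rw [← mul_pow]; norm_num
    rw [h16]
    nlinarith [mul_le_mul hπ4n h4n h4pos.le (by positivity), hL]

/-- **`hrow′/hcol′` of the step `n−1 → n` in the KL regime with the ABSOLUTE threshold `κ₀ = min (min (Dt_min/4) (ρ_min/4)) (1/40)`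
EXPOSED** (`B = bandBounds (−6/5) (−1/10)`): there is `C_B > 0` such that for every `R` (`Gfr ≥ 0`), `0 < c ≤ κ₀/(12(Gfr₂+1))`,
`0 < U ≤ min 1 (κ₀/(24(Gfr₀+Gfr₁+1)))`, `klBetaMin ≤ β ≤ e^{c/U²}`, `μ ∈ klWindowC`, `FrameOK R U (nScales β) μ K`, `β² ≤ L`, `β ≤ M`,
`1 ≤ n ≤ nScales β + 1`: every row sum is `≤ C_B·M/β` and every column sum `≤ 2C_B·M/β`. [cite: BenfattoGiulianiMastropietro2006, §2.7 (2.71a), §2.8 (2.77)] -/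
theorem overlap_sums_klAniso_bgmFat_of_thresholds (ha : (-4 : ℝ) < -(6 / 5)) (hab : (-(6 / 5) : ℝ) ≤ -(1 / 10))
    (hb : (-(1 / 10) : ℝ) < 0) :
    ∃ CB : ℝ, 0 < CB ∧ ∀ (R : RenConsts), (∀ j, 0 ≤ R.Gfr j) →
      ∀ (c U : ℝ), 0 < c →
      c ≤ min (min ((bandBounds ha hab hb).Dtmin / 4) ((bandBounds ha hab hb).rhomin / 4)) (1 / 40) / (12 * (R.Gfr 2 + 1)) → 0 < U →
      U ≤ min 1 (min (min ((bandBounds ha hab hb).Dtmin / 4) ((bandBounds ha hab hb).rhomin / 4)) (1 / 40) / (24 * (R.Gfr 0 + R.Gfr 1 + 1))) →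
      ∀ β : ℝ, klBetaMin ≤ β → β ≤ Real.exp (c / U ^ 2) → ∀ μ ∈ klWindowC, ∀ K : TrigPolyC4v, FrameOK R U (nScales β) μ K →
      ∀ (L M : ℕ) [NeZero L] [NeZero M], β ^ 2 ≤ (L : ℝ) → β ≤ (M : ℝ) → ∀ n : ℕ, 1 ≤ n → n ≤ nScales β + 1 →
        (∀ Y' : SpaceTimeIdx L M × SectorLeg (sectorCount n),
          ∑ Y, ‖(sectorAnalysisMatrix L M β (klAnisoFamily L M β μ K klE0 n) *
            sectorSubMatrix L M β (bgmFatMultiplier L M klE0 β (nambuXiCT L μ K) (n - 1))) Y' Y‖ ≤ CB * M / β) ∧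
        (∀ Y : SpaceTimeIdx L M × SectorLeg (sectorCount (n - 1)),
          ∑ Y', ‖(sectorAnalysisMatrix L M β (klAnisoFamily L M β μ K klE0 n) *
            sectorSubMatrix L M β (bgmFatMultiplier L M klE0 β (nambuXiCT L μ K) (n - 1))) Y' Y‖ ≤ 2 * CB * M / β) := by
  -- the window band bounds and the absolute frame-size threshold
  set B : BandBounds (-(6 / 5)) (-(1 / 10)) := bandBounds ha hab hb with hBdef
  set κ₀ : ℝ := min (min (B.Dtmin / 4) (B.rhomin / 4)) (1 / 40) with hκ₀
  have hDt := B.Dtmin_pos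
  have hrh := B.rhomin_pos
  have hκ₀pos : 0 < κ₀ := by rw [hκ₀]; exact lt_min (lt_min (by positivity) (by positivity)) (by norm_num)
  have hκ₀Dt : κ₀ ≤ B.Dtmin / 4 := (min_le_left _ _).trans (min_le_left _ _)
  have hκ₀rh : κ₀ ≤ B.rhomin / 4 := (min_le_left _ _).trans (min_le_right _ _)
  have hκ₀40 : κ₀ ≤ 1 / 40 := min_le_right _ _
  -- the cutoff constants
  have he : (0 : ℝ) < klE0 := by norm_num [klE0]
  obtain ⟨d₀, hd₀, hd₀1, hd₀2⟩ := exists_abs_derivs_bgmCutoffSq_le he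
  obtain ⟨B₀, hB₀0, hB₀⟩ := exists_norm_iteratedDeriv_sectorWeightCirc_polarAngle_line_le 2
  have hd : (0 : ℝ) < d₀ + 1 := by linarith
  have hd1 : ∀ u, |deriv (bgmCutoffSq klE0) u| ≤ d₀ + 1 := fun u => (hd₀1 u).trans (by linarith)
  have hd2 : ∀ u, |iteratedDeriv 2 (bgmCutoffSq klE0) u| ≤ d₀ + 1 := fun u => (hd₀2 u).trans (by linarith)
  have hBa : (0 : ℝ) < B₀ + 1 := by linarith
  have hB : ∀ (i : ℕ), i ≤ 2 → ∀ (n : ℕ) (ω : ℤ) (θ₀ : ℝ) (q w : Fin 2 → ℝ) (t : ℝ) {r₀ : ℝ}, 0 < r₀ →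
      r₀ ≤ ‖momToComplex (q + t • w)‖ → |sectorRelAngle θ₀ (q + t • w)| < π →
      ‖iteratedDeriv i (fun t : ℝ => sectorWeightCirc n ω (polarAngle (q + t • w))) t‖ ≤
        (2 : ℕ).factorial * (B₀ + 1) * ((1 + (sectorWidth n)⁻¹ * (2 : ℕ).factorial) * ‖momToComplex w‖ / r₀) ^ i := by
    intro i hi n ω θ₀ q w t r₀ hr₀ hr hθ
    refine (hB₀ i hi n ω θ₀ q w t hr₀ hr hθ).trans ?_
    have hX : 0 ≤ ((1 + (sectorWidth n)⁻¹ * (2 : ℕ).factorial) * ‖momToComplex w‖ / r₀) ^ i := by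
      have := sectorWidth_pos n; positivity
    have h2 : (0 : ℝ) ≤ (2 : ℕ).factorial := Nat.cast_nonneg _
    nlinarith [mul_nonneg h2 hX]
  -- the absolute constant
  set A : ℝ := κ₀ / 4 with hAdef
  have hA0 : 0 < A := by rw [hAdef]; positivity
  have hDtA : 0 < B.Dtmin - 2 * A := by rw [hAdef]; linarith
  have hrhA : 0 < 2 * B.rhomin - 4 * A := by rw [hAdef]; linarith
  have hsm := B.smax_pos
  have hπ := Real.pi_pos
  obtain ⟨ρb, hρb⟩ : ∃ ρb : ℝ, ρb = (klE0 + 3 * π / 2 * B.smax * B.Dtmin) / (B.Dtmin - 2 * A) := ⟨_, rfl⟩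
  obtain ⟨cG, hcG⟩ : ∃ cG : ℝ, cG = 4 * ((d₀ + 1) * klE0 ^ 4 * 1 + 2 * ((d₀ + 1) * klE0 ^ 2) * ((d₀ + 1) * klE0 ^ 2) +
      1 * ((d₀ + 1) * klE0 ^ 4)) + 2 * ((d₀ + 1) * klE0 ^ 2 * 1 + 1 * ((d₀ + 1) * klE0 ^ 2)) := ⟨_, rfl⟩
  obtain ⟨c1, hc1⟩ : ∃ c1 : ℝ, c1 = (d₀ + 1) * klE0 ^ 2 * 1 + 1 * ((d₀ + 1) * klE0 ^ 2) := ⟨_, rfl⟩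
  obtain ⟨Y, hY⟩ : ∃ Y : ℝ, Y = (4 + 2 * A) + (4 + 4 * A) * (2 * ρb + 5) := ⟨_, rfl⟩
  obtain ⟨κ, hκ⟩ : ∃ κ : ℝ, κ = cG * Y ^ 2 + 2 * c1 * (4 + 4 * A) * (9 / 4) * klE0 + 8 * c1 * (B₀ + 1) * Y * 12 * klE0 +
      2 * (B₀ + 1) * 72 * klE0 ^ 2 + 8 * (B₀ + 1) ^ 2 * 36 * klE0 ^ 2 := ⟨_, rfl⟩
  obtain ⟨κX, hκX⟩ : ∃ κX : ℝ, κX = 4 * (3 * Real.sqrt 2 * π * Real.sqrt κ + 2 * klE0) ^ 2 / klE0 +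
      96 / (π * klE0 ^ 2) * ((π * Real.sqrt κ / 2) * (π * Real.sqrt κ / 2 + klE0) ^ 2) := ⟨_, rfl⟩
  obtain ⟨cN1, hcN1⟩ : ∃ cN1 : ℝ, cN1 = Real.sqrt 2 * (klE0 + (4 + 4 * A) * ρb ^ 2) / ((2 * B.rhomin - 4 * A) * π) + 2 := ⟨_, rfl⟩
  obtain ⟨cN2, hcN2⟩ : ∃ cN2 : ℝ, cN2 = 2 * Real.sqrt 2 * ρb / π + 2 := ⟨_, rfl⟩
  have hρb0 : 0 ≤ ρb := by rw [hρb]; positivity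
  have hcG0 : 0 < cG := by rw [hcG]; positivity
  have hκX0 : 0 < κX := by rw [hκX]; positivity
  have hcN10 : 0 < cN1 := by rw [hcN1]; positivity
  have hcN20 : 0 < cN2 := by rw [hcN2]; positivity
  have hS0 : 0 < Real.sqrt (2048 * (π * Real.sqrt cG + 1) * κX * (160 / π * (cN1 * cN2)) / klE0) :=
    Real.sqrt_pos.2 (by positivity)
  refine ⟨81 * Real.sqrt (2048 * (π * Real.sqrt cG + 1) * κX * (160 / π * (cN1 * cN2)) / klE0), by positivity, ?_⟩
  intro R hR c U hc hcle hU hUle β hβmin hβc μ hμ K hK L M _ _ hLβ hMβ n hn hnN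
  have hβ0 : 0 < β := pos_of_klBetaMin_le hβmin
  -- the frame's `C²` size is `≤ A = κ₀/4`
  have hlog : 1 ≤ Real.log 4 := by
    have h4 : Real.exp 1 ≤ 4 := by have := Real.exp_one_lt_d9; norm_num at this; linarith
    calc (1 : ℝ) = Real.log (Real.exp 1) := (Real.log_exp 1).symm
      _ ≤ Real.log 4 := Real.log_le_log (Real.exp_pos 1) h4
  have hAK : ∀ p : Momentum, ∀ j ≤ 2, ‖iteratedFDeriv ℝ j (frameShift K) p‖ ≤ A := by
    intro p j hj
    refine (norm_iteratedFDeriv_frameShift_le_of_frameOK_regime hR hc.le hβmin hβc hK p hj).trans ?_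
    have h0 := hR 0; have h1 := hR 1; have h2 := hR 2
    have hU1 : U ≤ 1 := hUle.trans (min_le_left _ _)
    have hUk : U ≤ κ₀ / (24 * (R.Gfr 0 + R.Gfr 1 + 1)) := hUle.trans (min_le_right _ _)
    rw [abs_of_pos hU]
    have hU2 : U ^ 2 ≤ U := by nlinarith only [hU, hU1]
    have hA1 : 2 * R.Gfr 0 * U + 2 * R.Gfr 1 * U ^ 2 ≤ 2 * (R.Gfr 0 + R.Gfr 1 + 1) * U := by
      have := mul_le_mul_of_nonneg_left hU2 h1
      linarith only [this, hU.le]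
    have hB1 : 2 * (R.Gfr 0 + R.Gfr 1 + 1) * U ≤ κ₀ / 12 := by
      have hpos : 0 < 24 * (R.Gfr 0 + R.Gfr 1 + 1) := by positivity
      have := (le_div_iff₀ hpos).mp hUk
      linarith only [this]
    have hC1 : R.Gfr 2 * (c / Real.log 4) ≤ R.Gfr 2 * c := mul_le_mul_of_nonneg_left (div_le_self hc.le hlog) h2
    have hD1 : R.Gfr 2 * c ≤ κ₀ / 12 := by
      have hpos : 0 < 12 * (R.Gfr 2 + 1) := by positivity
      have := (le_div_iff₀ hpos).mp hcle
      linarith only [this, hc.le]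
    rw [hAdef]; linarith only [hA1, hB1, hC1, hD1, hκ₀pos]
  -- the window margins
  have hμ' := hμ
  simp only [klWindowC, Set.mem_Icc] at hμ'
  have e1 : (-1.05 : ℝ) = -(21 / 20) := by norm_num
  have e2 : (-0.15 : ℝ) = -(3 / 20) := by norm_num
  have hμlo : -(21 / 20 : ℝ) ≤ μ := by rw [← e1]; exact hμ'.1
  have hμhi : μ ≤ -(3 / 20 : ℝ) := by rw [← e2]; exact hμ'.2
  have he0 : klE0 = 1 / 32 := rfl
  have hgap : klE0 + A + (1 / 10 : ℝ) ^ 2 < -μ := by rw [he0, hAdef]; linarith only [hμhi, hκ₀40]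
  have h3 : klE0 + A - μ ≤ 3 := by rw [he0, hAdef]; linarith only [hμlo, hκ₀40]
  have hlo : (-(6 / 5) : ℝ) ≤ μ - A - klE0 := by rw [he0, hAdef]; linarith only [hμlo, hκ₀40]
  have hhi : μ + A + klE0 ≤ -(1 / 10) := by rw [he0, hAdef]; linarith only [hμhi, hκ₀40]
  have hADt : 2 * A < B.Dtmin := by rw [hAdef]; linarith
  have hρA : 4 * A < 2 * B.rhomin := by rw [hAdef]; linarith
  -- the scale thresholds
  obtain ⟨hM, hMβ', hLz, hL16, hΛβ⟩ := regime_scale_thresholds hβmin hLβ hMβ hnN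
  have h := overlap_sums_klAniso_bgmFat_le (L := L) (M := M) (μ := μ) (K := K) B hAK hADt he (by norm_num : (0 : ℝ) < 1 / 10)
    (by norm_num : (1 / 10 : ℝ) ≤ 1) hgap h3 hlo hhi hβ0 hρA hd hd1 hd2 hBa hB hcG hc1 hρb hY hκ hκX hcN1 hcN2 hn hM hMβ' hLz hL16 hΛβ
  refine ⟨fun Y' => (h.1 Y').trans (le_of_eq (by ring)), fun Y => (h.2 Y).trans (le_of_eq (by ring))⟩

/-- **`hrow′/hcol′` of the step `n−1 → n` in the KL regime, on EVERY admissible frame, with ONE absolute constant.**  There are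
`κ₀ > 0` and `C_B > 0` such that for every renormalisation package `R` (`Gfr ≥ 0`), every regime constant `0 < c ≤ κ₀/(12(Gfr₂+1))`, coupling
`0 < U ≤ min 1 (κ₀/(24(Gfr₀+Gfr₁+1)))`, `klBetaMin ≤ β ≤ e^{c/U²}`, `μ ∈ klWindowC`, frame `FrameOK R U (nScales β) μ K`, volume and time
cut-offs `β² ≤ L`, `β ≤ M`, and scale `1 ≤ n ≤ nScales β + 1`: every row sum of `‖(E′(klAnisoFamily … n)·S(F̃_{n−1}))(Y′, Y)‖` is
`≤ C_B·M/β` and every column sum `≤ 2C_B·M/β`. [cite: BenfattoGiulianiMastropietro2006, §2.7 (2.71a), §2.8 (2.77)] -/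
theorem overlap_sums_klAniso_bgmFat_of_frameOK :
    ∃ κ₀ : ℝ, 0 < κ₀ ∧ ∃ CB : ℝ, 0 < CB ∧ ∀ (R : RenConsts), (∀ j, 0 ≤ R.Gfr j) →
      ∀ (c U : ℝ), 0 < c → c ≤ κ₀ / (12 * (R.Gfr 2 + 1)) → 0 < U → U ≤ min 1 (κ₀ / (24 * (R.Gfr 0 + R.Gfr 1 + 1))) →
      ∀ β : ℝ, klBetaMin ≤ β → β ≤ Real.exp (c / U ^ 2) → ∀ μ ∈ klWindowC, ∀ K : TrigPolyC4v, FrameOK R U (nScales β) μ K →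
      ∀ (L M : ℕ) [NeZero L] [NeZero M], β ^ 2 ≤ (L : ℝ) → β ≤ (M : ℝ) → ∀ n : ℕ, 1 ≤ n → n ≤ nScales β + 1 →
        (∀ Y' : SpaceTimeIdx L M × SectorLeg (sectorCount n),
          ∑ Y, ‖(sectorAnalysisMatrix L M β (klAnisoFamily L M β μ K klE0 n) *
            sectorSubMatrix L M β (bgmFatMultiplier L M klE0 β (nambuXiCT L μ K) (n - 1))) Y' Y‖ ≤ CB * M / β) ∧
        (∀ Y : SpaceTimeIdx L M × SectorLeg (sectorCount (n - 1)),
          ∑ Y', ‖(sectorAnalysisMatrix L M β (klAnisoFamily L M β μ K klE0 n) *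
            sectorSubMatrix L M β (bgmFatMultiplier L M klE0 β (nambuXiCT L μ K) (n - 1))) Y' Y‖ ≤ 2 * CB * M / β) := by
  have ha : (-4 : ℝ) < -(6 / 5) := by norm_num
  have hab : (-(6 / 5) : ℝ) ≤ -(1 / 10) := by norm_num
  have hb : (-(1 / 10) : ℝ) < 0 := by norm_num
  obtain ⟨CB, hCB, h⟩ := overlap_sums_klAniso_bgmFat_of_thresholds ha hab hb
  have hDt := (bandBounds ha hab hb).Dtmin_pos
  have hrh := (bandBounds ha hab hb).rhomin_pos
  exact ⟨_, lt_min (lt_min (by positivity) (by positivity)) (by norm_num), CB, hCB, h⟩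

/-- **`hrow′/hcol′` under EXACTLY the binders of `stub_engine_step_norms`** (`P.WF`, `R.WF2`, `0 < c ≤ klEngC₃3 P R`, `μ ∈ klWindowC`,
`0 < U ≤ klEngU₀3 P R c`, `klBetaMin ≤ β ≤ e^{c/U²}`, `FrameOK R U (nScales β) μ K`, `klEngL₃ β U ≤ L`, `klEngM₃ β U L ≤ M`, `1 ≤ n ≤ nScales β + 1`):
ONE constant `C_B > 0` with every row sum `≤ C_B·M/β` and every column sum `≤ 2C_B·M/β` for the pair
`(klAnisoFamily … klE0 n, bgmFatMultiplier … klE0 … (n−1))` — the package thresholds are below the absolute ones (`klEngC₃3_le_symbolC₃`,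
`klEngU₀3_le_symbolU₀`), `Gfr ≥ 0` by `R.WF2`, `β² ≤ L` / `β ≤ M` by `sq_le_of_klEngL₃_le` / `le_of_klEngM₃_le`.
[cite: BenfattoGiulianiMastropietro2006, §2.7 (2.71a), §2.8 (2.77)] -/
theorem overlap_sums_klAniso_bgmFat_klEng :
    ∃ CB : ℝ, 0 < CB ∧ ∀ (P : SplitConsts) (R : RenConsts) (c : ℝ), P.WF → R.WF2 → 0 < c → c ≤ EngineV8.klEngC₃3 P R →
      ∀ μ ∈ klWindowC, ∀ U : ℝ, 0 < U → U ≤ EngineV8.klEngU₀3 P R c → ∀ β : ℝ, klBetaMin ≤ β → β ≤ Real.exp (c / U ^ 2) →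
      ∀ K : TrigPolyC4v, FrameOK R U (nScales β) μ K → ∀ (L M : ℕ) [NeZero L] [NeZero M],
      EngineV8.klEngL₃ β U ≤ L → EngineV8.klEngM₃ β U L ≤ M → ∀ n : ℕ, 1 ≤ n → n ≤ nScales β + 1 →
        (∀ Y' : SpaceTimeIdx L M × SectorLeg (sectorCount n),
          ∑ Y, ‖(sectorAnalysisMatrix L M β (klAnisoFamily L M β μ K klE0 n) *
            sectorSubMatrix L M β (bgmFatMultiplier L M klE0 β (nambuXiCT L μ K) (n - 1))) Y' Y‖ ≤ CB * M / β) ∧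
        (∀ Y : SpaceTimeIdx L M × SectorLeg (sectorCount (n - 1)),
          ∑ Y', ‖(sectorAnalysisMatrix L M β (klAnisoFamily L M β μ K klE0 n) *
            sectorSubMatrix L M β (bgmFatMultiplier L M klE0 β (nambuXiCT L μ K) (n - 1))) Y' Y‖ ≤ 2 * CB * M / β) := by
  have ha : (-4 : ℝ) < -(6 / 5) := by norm_num
  have hab : (-(6 / 5) : ℝ) ≤ -(1 / 10) := by norm_num
  have hb : (-(1 / 10) : ℝ) < 0 := by norm_num
  obtain ⟨CB, hCB, h⟩ := overlap_sums_klAniso_bgmFat_of_thresholds ha hab hb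
  refine ⟨CB, hCB, ?_⟩
  intro P R c _ hR2 hc hc3 μ hμ U hU hU0 β hβmin hβc K hK L M _ _ hL3 hM3 n hn hnN
  have hRj : ∀ j, 0 ≤ R.Gfr j := EngineV8.gfr_nonneg_of_wf2 hR2
  exact h R hRj c U hc (hc3.trans (EngineV8.klEngC₃3_le_symbolC₃ ha hab hb P hRj)) hU
    (hU0.trans (EngineV8.klEngU₀3_le_symbolU₀ ha hab hb P hRj c)) β hβmin hβc μ hμ K hK L M
    (EngineV8.sq_le_of_klEngL₃_le hL3) (EngineV8.le_of_klEngM₃_le hβmin hL3 hM3) n hn hnN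

end Summit.HubbardSuperconductivity.HubbardSuperconductivity.Theorems.TorusFourierL2

end
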